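import Mathlib
import Summits.Ventures.PercRepro2.HCov
import Summits.Ventures.PercRepro2.MonoTPos
import Summits.Ventures.PercRepro2.GcInterior
import Summits.Ventures.PercRepro2.GcSkelCutShape
import Summits.Ventures.PercRepro2.GcSkelMarksConn
import Summits.Ventures.PercRepro2.GcSkelTwoConnected
import Summits.Ventures.PercRepro2.GcSkelReductionMinH

/-!
# Interior weights: every non-empty event has positive probability, and on the residual the
masses `P(Q)`, `D`, `P(T)`, `P(T′)` are positive (blind cell PercRepro2, typer-1 g55)

At interior weights (`IsIntVec p`, `GcInterior.lean`) every configuration has positive weight,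
so `prob p A > 0` exactly when `A` is non-empty (`prob_pos_of_int`, `prob_pos_iff_of_int`; the
single-configuration bound `weight_le_prob_of_mem` and the all-closed configuration's API
`conn_allClosed_iff` / `allClosed_mem_avoidAll` are typer-1's `MonoTPos.lean`, reused).
The all-closed configuration lies in `Q = {a₁ ↮ a₂}` and in `PD = Q ∩ {a₃ ∉ U}` as soon as the
three marks are distinct (`PQ_pos_of_int`, `PD_pos_of_int`); the configuration `G − a₁` lies in
`T = {a₁ ∉ C₂, a₃ ∈ C₂}` as soon as `a₂ ↔ a₃` in `G − a₁` (`T_pos_of_int`), which holds on the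
weighted residual: `a₃` has an unmarked neighbour `z` (`¬R₃`), and `z` is joined to any
non-isolated vertex off `{v, a₃}` in `G − v` for a marked `v` (two-connectivity off `a₃`,
`conn_sepConfig_of_wredI`) — **`conn_sepConfig_a3_of_wredI`**, **`T_pos_of_wredI`**,
**`T'_pos_of_wredI`**, and the same on the class of record (`wredI_of_wredMinH`).

Use: the division-based forms of the cell (`γ = D_o / D`, the conditional laws under `Q`, `PD`,
`T′`, the non-degeneracy hypotheses `P(Q), D, P(T′) > 0` of S5's `rv_of_canonPM`) hold without
side conditions at interior weights on the residual; `HCov_of_int` (`GcInterior.lean`) carries a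
proof obtained there back to every admissible weight.
-/

namespace Summit.Ventures.PercRepro2

open CovForm UnionCluster RECM SepPair

/-! ## Positive weights -/

section Pos

variable {E : Type*} [Fintype E] [DecidableEq E] {R : Type*} [Field R] [LinearOrder R]
  [IsStrictOrderedRing R]

omit [Fintype E] [DecidableEq E] in
/-- The Bernoulli factors are positive for `q ∈ (0, 1)`. -/
lemma edgeFactor_pos {q : R} (h0 : 0 < q) (h1 : q < 1) (b : Bool) : 0 < edgeFactor q b := by
  cases b
  · exact (sub_pos.2 h1 : (0 : R) < 1 - q)
  · exact h0

omit [DecidableEq E] in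
/-- At interior weights every configuration has positive weight. -/
lemma weight_pos_of_int {p : E → R} (hp : IsIntVec p) (ω : Config E) : 0 < weight p ω :=
  Finset.prod_pos fun e _ => edgeFactor_pos (hp.pos e) (hp.lt_one e) _

/-- At interior weights a non-empty event has positive probability. -/
lemma prob_pos_of_int {p : E → R} (hp : IsIntVec p) {A : Set (Config E)} (hA : A.Nonempty) :
    0 < prob p A := by
  obtain ⟨ω, hω⟩ := hA
  exact (weight_pos_of_int hp ω).trans_le (weight_le_prob_of_mem hp.isProbVec hω)

/-- **At interior weights, `P(A) > 0 ↔ A ≠ ∅`.** -/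
lemma prob_pos_iff_of_int {p : E → R} (hp : IsIntVec p) {A : Set (Config E)} :
    0 < prob p A ↔ A.Nonempty := by
  constructor
  · intro h
    by_contra hA
    rw [Set.not_nonempty_iff_eq_empty] at hA
    rw [hA, prob_empty] at h
    exact lt_irrefl _ h
  · exact prob_pos_of_int hp

end Pos

/-! ## The all-closed configuration and `G − v` -/

section Closed

variable {V : Type*} {E : Type*}

/-- `PD = {a₁ ↮ a₂, a₃ ∉ C₁ ∪ C₂}` contains the all-closed configuration. -/
lemma allClosed_mem_PDEvent {ends : E → Sym2 V} {a₁ a₂ a₃ : V} (h12 : a₁ ≠ a₂) (h13 : a₁ ≠ a₃)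
    (h23 : a₂ ≠ a₃) : (fun _ => false) ∈ PDEvent ends a₁ a₂ a₃ := by
  refine ⟨fun h => h12 ((conn_allClosed_iff _ _ _).1 h), fun h => ?_⟩
  rcases (Set.mem_union _ _ _).1 h with h | h
  · exact h13 ((conn_allClosed_iff _ _ _).1 h).symm
  · exact h23 ((conn_allClosed_iff _ _ _).1 h).symm

/-- `a₁` is isolated in `G − a₁`: no vertex other than `a₁` reaches it. -/
lemma not_conn_sepConfig_singleton {ends : E → Sym2 V} {v x : V} (hxv : x ≠ v) :
    ¬ Conn ends (sepConfig ends {v}) x v := fun h =>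
  not_mem_of_conn_sepConfig (A := {v}) (by simpa using hxv) h (Set.mem_singleton v)

/-- `T = {a₁ ∉ C₂, a₃ ∈ C₂}` contains `G − a₁` as soon as `a₂ ↔ a₃` in `G − a₁`. -/
lemma sepConfig_mem_TEvent {ends : E → Sym2 V} {a₁ a₂ a₃ : V} (h12 : a₁ ≠ a₂)
    (hconn : Conn ends (sepConfig ends {a₁}) a₂ a₃) :
    sepConfig ends {a₁} ∈ TEvent ends a₁ a₂ a₃ :=
  ⟨not_conn_sepConfig_singleton h12.symm, hconn⟩

end Closed

/-! ## The masses at interior weights -/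

section Masses

variable {V : Type*} {E : Type*} [Fintype E] [DecidableEq E] {R : Type*} [Field R]
  [LinearOrder R] [IsStrictOrderedRing R]

/-- **`P(Q) > 0`** at interior weights when `a₁ ≠ a₂`. -/
theorem PQ_pos_of_int {p : E → R} (hp : IsIntVec p) (ends : E → Sym2 V) {a₁ a₂ : V}
    (h12 : a₁ ≠ a₂) : 0 < prob p (avoidAll ends a₂ {a₁}) :=
  prob_pos_of_int hp ⟨_, allClosed_mem_avoidAll ends (by simpa using h12.symm)⟩

/-- **`D = P(PD) > 0`** at interior weights when the three marks are distinct. -/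
theorem PD_pos_of_int {p : E → R} (hp : IsIntVec p) (ends : E → Sym2 V) {a₁ a₂ a₃ : V}
    (h12 : a₁ ≠ a₂) (h13 : a₁ ≠ a₃) (h23 : a₂ ≠ a₃) : 0 < prob p (PDEvent ends a₁ a₂ a₃) :=
  prob_pos_of_int hp ⟨_, allClosed_mem_PDEvent h12 h13 h23⟩

/-- **`P(T) > 0`** at interior weights when `a₂ ↔ a₃` in `G − a₁`. -/
theorem T_pos_of_int {p : E → R} (hp : IsIntVec p) (ends : E → Sym2 V) {a₁ a₂ a₃ : V}
    (h12 : a₁ ≠ a₂) (hconn : Conn ends (sepConfig ends {a₁}) a₂ a₃) :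
    0 < prob p (TEvent ends a₁ a₂ a₃) :=
  prob_pos_of_int hp ⟨_, sepConfig_mem_TEvent h12 hconn⟩

end Masses

/-! ## On the residual: `a₃` reaches every non-isolated vertex in `G − v`, `v` a mark -/

namespace WRed

section Residual

variable {V : Type*} {E : Type*} [Fintype E] [DecidableEq V]
variable {ends : E → Sym2 V} {o a₁ a₂ a₃ b : V}

/-- **On the residual `a₃` is joined, in `G − v` for any marked `v ≠ a₃`, to every non-isolated
vertex `y ∉ {v, a₃}`**: the unmarked neighbour `z` of `a₃` (`¬R₃`) is not `v`, the edge `{a₃, z}`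
survives in `G − v`, and `z ↔ y` there by two-connectivity off `a₃`. -/
theorem conn_sepConfig_a3_of_wredI (h : WReducedI ends o a₁ a₂ a₃ b)
    (h12 : a₁ ≠ a₂) (h13 : a₁ ≠ a₃) (h23 : a₂ ≠ a₃) (ho1 : o ≠ a₁) (ho2 : o ≠ a₂) (ho3 : o ≠ a₃)
    (hob : o ≠ b) (hb1 : b ≠ a₁) (hb2 : b ≠ a₂) (hb3 : b ≠ a₃) {v y : V}
    (hv : ¬ Unmarked o a₁ a₂ a₃ b v) (hv3 : v ≠ a₃) (hyv : y ≠ v) (hy3 : y ≠ a₃)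
    (hy : ∃ e, y ∈ ends e ∧ ¬ (ends e).IsDiag) : Conn ends (sepConfig ends {v}) a₃ y := by
  obtain ⟨e, z, he, hz⟩ := exists_a3_edge_of_not_a3ToMarks h.notR3
  have hzv : z ≠ v := fun hzv => hv (hzv ▸ hz)
  have hz3 : z ≠ a₃ := hz.2.2.2.1
  -- the edge `{a₃, z}` is open in `G − v`
  have hopen : sepConfig ends {v} e = true := by
    refine sepConfig_eq_true fun ht => ?_
    obtain ⟨x, hx, w, hxw⟩ := ht
    rw [Set.mem_singleton_iff] at hx
    subst hx
    have hmem : x ∈ ends e := by rw [hxw]; exact Sym2.mem_mk_left _ _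
    rw [he, Sym2.mem_iff] at hmem
    rcases hmem with h' | h'
    · exact hv3 h'
    · exact hzv h'.symm
  have hz_y : Conn ends (sepConfig ends {v}) z y :=
    conn_sepConfig_of_wredI h h12 h13 h23 ho1 ho2 ho3 hob hb1 hb2 hb3 hzv hyv hz3 hy3
      ⟨e, by rw [he]; exact Sym2.mem_mk_right _ _, by rw [he, Sym2.mk_isDiag_iff]; exact hz3.symm⟩
      hy
  exact conn_trans (conn_of_openAdj ⟨e, hopen, he⟩) hz_y

/-- `a₂ ↔ a₃` in `G − a₁` on the residual. -/
theorem conn_sepConfig_a1_of_wredI (h : WReducedI ends o a₁ a₂ a₃ b)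
    (h12 : a₁ ≠ a₂) (h13 : a₁ ≠ a₃) (h23 : a₂ ≠ a₃) (ho1 : o ≠ a₁) (ho2 : o ≠ a₂) (ho3 : o ≠ a₃)
    (hob : o ≠ b) (hb1 : b ≠ a₁) (hb2 : b ≠ a₂) (hb3 : b ≠ a₃) :
    Conn ends (sepConfig ends {a₁}) a₂ a₃ :=
  conn_symm (conn_sepConfig_a3_of_wredI h h12 h13 h23 ho1 ho2 ho3 hob hb1 hb2 hb3
    (fun hu => hu.2.1 rfl) h13 h12.symm h23 (exists_edge_of_not_isolated h.notIso_a2))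

/-- `a₁ ↔ a₃` in `G − a₂` on the residual. -/
theorem conn_sepConfig_a2_of_wredI (h : WReducedI ends o a₁ a₂ a₃ b)
    (h12 : a₁ ≠ a₂) (h13 : a₁ ≠ a₃) (h23 : a₂ ≠ a₃) (ho1 : o ≠ a₁) (ho2 : o ≠ a₂) (ho3 : o ≠ a₃)
    (hob : o ≠ b) (hb1 : b ≠ a₁) (hb2 : b ≠ a₂) (hb3 : b ≠ a₃) :
    Conn ends (sepConfig ends {a₂}) a₁ a₃ :=
  conn_symm (conn_sepConfig_a3_of_wredI h h12 h13 h23 ho1 ho2 ho3 hob hb1 hb2 hb3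
    (fun hu => hu.2.2.1 rfl) h23 h12 h13 (exists_edge_of_not_isolated h.notIso_a1))

end Residual

section ResidualMasses

variable {V : Type*} {E : Type*} [Fintype E] [DecidableEq E] [DecidableEq V] {R : Type*}
  [Field R] [LinearOrder R] [IsStrictOrderedRing R]
variable {ends : E → Sym2 V} {o a₁ a₂ a₃ b : V}

/-- **`P(T) > 0` on the residual at interior weights.** -/
theorem T_pos_of_wredI {p : E → R} (hp : IsIntVec p) (h : WReducedI ends o a₁ a₂ a₃ b)
    (h12 : a₁ ≠ a₂) (h13 : a₁ ≠ a₃) (h23 : a₂ ≠ a₃) (ho1 : o ≠ a₁) (ho2 : o ≠ a₂) (ho3 : o ≠ a₃)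
    (hob : o ≠ b) (hb1 : b ≠ a₁) (hb2 : b ≠ a₂) (hb3 : b ≠ a₃) :
    0 < prob p (TEvent ends a₁ a₂ a₃) :=
  T_pos_of_int hp ends h12
    (conn_sepConfig_a1_of_wredI h h12 h13 h23 ho1 ho2 ho3 hob hb1 hb2 hb3)

/-- **`P(T′) > 0` on the residual at interior weights** (`T′ = TEvent ends a₂ a₁ a₃`). -/
theorem T'_pos_of_wredI {p : E → R} (hp : IsIntVec p) (h : WReducedI ends o a₁ a₂ a₃ b)
    (h12 : a₁ ≠ a₂) (h13 : a₁ ≠ a₃) (h23 : a₂ ≠ a₃) (ho1 : o ≠ a₁) (ho2 : o ≠ a₂) (ho3 : o ≠ a₃)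
    (hob : o ≠ b) (hb1 : b ≠ a₁) (hb2 : b ≠ a₂) (hb3 : b ≠ a₃) :
    0 < prob p (TEvent ends a₂ a₁ a₃) :=
  T_pos_of_int hp ends h12.symm
    (conn_sepConfig_a2_of_wredI h h12 h13 h23 ho1 ho2 ho3 hob hb1 hb2 hb3)

/-- The class of record lies in the g53 residual. -/
theorem wredI_of_wredMinH (h : WReducedMinH ends o a₁ a₂ a₃ b) : WReducedI ends o a₁ a₂ a₃ b :=
  (wredH_iff_wredMinH.2 h).toWReducedOB.toWReducedO.toWReducedT.toWReducedI

/-- **On the class of record at interior weights, `P(Q)`, `D`, `P(T)` and `P(T′)` are all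
positive.** -/
theorem masses_pos_of_wredMinH {p : E → R} (hp : IsIntVec p) (h : WReducedMinH ends o a₁ a₂ a₃ b)
    (h12 : a₁ ≠ a₂) (h13 : a₁ ≠ a₃) (h23 : a₂ ≠ a₃) (ho1 : o ≠ a₁) (ho2 : o ≠ a₂) (ho3 : o ≠ a₃)
    (hob : o ≠ b) (hb1 : b ≠ a₁) (hb2 : b ≠ a₂) (hb3 : b ≠ a₃) :
    0 < prob p (avoidAll ends a₂ {a₁}) ∧ 0 < prob p (PDEvent ends a₁ a₂ a₃) ∧
      0 < prob p (TEvent ends a₁ a₂ a₃) ∧ 0 < prob p (TEvent ends a₂ a₁ a₃) :=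
  ⟨PQ_pos_of_int hp ends h12, PD_pos_of_int hp ends h12 h13 h23,
    T_pos_of_wredI hp (wredI_of_wredMinH h) h12 h13 h23 ho1 ho2 ho3 hob hb1 hb2 hb3,
    T'_pos_of_wredI hp (wredI_of_wredMinH h) h12 h13 h23 ho1 ho2 ho3 hob hb1 hb2 hb3⟩

end ResidualMasses

end WRed

end Summit.Ventures.PercRepro2
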